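import Literature.AnabelianGeometry.EtaleTheta.Discharge.Sec1Prop15PrimitiveModelChi
import Literature.AnabelianGeometry.EtaleTheta.KummerDataYCoordFiltration
import Literature.AnabelianGeometry.EtaleTheta.SettingModelTateKummerData
import Literature.AnabelianGeometry.EtaleTheta.SettingModelCyclotomicCharacterInvariants
import Literature.AnabelianGeometry.EtaleTheta.ContH1ResInjective
import HarnessLib

/-!
# [EtTh] Rmk. 1.3.1 / Prop. 1.5 (i) at the STAGE-2 (Tate-sheared) χ-model `modelχq`: `log(U)` has no `n`-th root
# over `Y`, even modulo the Kummer classes — GENERIC over a `y`-coordinate kit, instantiated at F6q (proof-only)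

S. Mochizuki, *The étale theta function …*, Publ. RIMS **45** (2009) [EtTh], §1, Rmk. 1.3.1 p. 21 ("the
denominators `½` in Proposition 1.3 are by no means superfluous"), Prop. 1.5 (i) p. 23 ("`F¹/F² = Ẑ · log(U)`",
"`log(Ü) = ½ · log(U)`") [cite: MochizukiEtTh2009, Prop 1.5 p.23].

PROOF-ONLY companion (abc-iut cell, block F, seat abc-iut-f-117 gen 4; instance-form CONTENT of the FACT-LIST rows
F-0523 `Rmk131` / F-2502 `Prop15i` at the stage-2 datum; no `def`, no instance, no Prop fact).

§1 (GENERIC, over abc-iut-w5-d171's `ThetaSetting.YCoordKit` and `KummerCore`, in the style of abc-iut-w5-d181's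
`KummerDataYCoordFiltration`): for ANY theta setting `D`, ANY kit `K` with `ι : Ẑ → Δ_Θ` bijective and ANY element
`h ∈ (Π^tp_Y)^Θ` centralising `Δ_Θ` with `ŷ(h) = ι(1)`:
* `YCoordKit.logU_mul_mk_not_pow_of_y_eq` — `K.logU · [g]` is not an `n`-th power (`n ≥ 2`) for any cocycle `g`
  vanishing at `h`; `YCoordKit.logU_not_pow_of_y_eq`; with a Kummer core `C` such that `aug^Θ(h) = 1`:
  `YCoordKit.logU_mul_kumY_not_pow_of_y_eq` — **`K.logU · κ(u)` is not an `n`-th power for any constant `u`**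
  (Kummer cocycles of constants vanish at `h`: `KummerCore.kummerContMap_apply_eq_one`);
* `YCoordKit.logUdd_not_mem_range_res_of_y_eq` — if moreover restriction `Y → Ÿ` is injective on `H¹`, `K.logUdd` is
  NOT a restricted class («`D₁` does not descend to `Y`»).

§2 (STAGE 2): at abc-iut-L2-t5's Tate-sheared model `ThetaSetting.modelχq p i j hj` with abc-iut-w5-d171's F6q
Kummer data `kummerDataχq` (kit `yCoordKitχq`: `ι = deltaThetaCoordχq` bijective, geometric element
`b = (b, 0) ⋊ 1 ∈ Π^tp_Y` with `ŷ(b) = ι(1)`; the four one-line facts about `b` are re-derived inline from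
abc-iut-L2-t5's / abc-iut-w5-d171's definitions, as abc-iut-w5-d181's `SettingModelTateKummerDataFiltration` — which
has them by name — is not yet served as an olean on the farm at the time of writing): `logU_not_pow_modelχq`,
**`logU_mul_kumY_not_pow_modelχq`** (`log(U)` primitive modulo `F²` at stage 2), `logU_not_sq_modelχq` (no `½·log(U)`
over `Y` at stage 2), `res_gtpYdd_injective_modelχq` and **`logUdd_not_mem_range_res_modelχq`** (`log(Ü)` does not
descend to `Y` at stage 2) — the stage-2 column of the Rmk. 1.3.1 / Prop. 1.5 (i) NV rows (stage 1: `Sec1Rmk131ModelChiNoHalf`,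
`Sec1Prop15PrimitiveModelChi`, `Sec1Rmk131ModelChiCuspTwins`).

HONEST FRAMING: semi-synthetic models (stage 2 = Tate shear on the longitude), consistency evidence only; nothing of
[EtTh] is asserted; no side is taken on [IUTchIII] Cor. 3.12; typed ≠ proved.
-/

noncomputable section

open Topology

namespace Literature.AnabelianGeometry.EtaleTheta

open scoped IsMulCommutative

namespace ThetaSetting

variable {p : ℕ} [Fact p.Prime] {D : ThetaSetting p}

/-! ## §1. Generic: a `y`-coordinate kit with bijective `ι` and a test element with `ŷ = ι(1)` -/

namespace YCoordKit

variable (K : D.YCoordKit)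

/-- The `log(U)`-cocycle of a kit at `h` is `ι(ŷ h)` (definitional). [cite: MochizukiEtTh2009, Prop 1.5 p.23] -/
theorem logUFun_apply (h : ↥(D.GtpY.map D.toTheta)) : K.logUFun h = K.iota (K.y h) := rfl

/-- **`K.logU · [g]` is not an `n`-th power over `Y` (`n ≥ 2`)** when `ι` is bijective, `h ∈ (Π^tp_Y)^Θ` centralises
`Δ_Θ`, `ŷ(h) = ι(1)`, and the cocycle `g` vanishes at `h`: an `n`-th root `[f]` would give `f(h)ⁿ = ι(ι(1))`, i.e.
`ι(1) ∈ nẐ`. [cite: MochizukiEtTh2009, Prop 1.5 p.23] -/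
theorem logU_mul_mk_not_pow_of_y_eq (hbij : Function.Bijective K.iota) {n : ℕ} (hn : 2 ≤ n)
    {h : D.GtpTheta} (hh : h ∈ D.GtpY.map D.toTheta) (hcent : ∀ a : D.DeltaTheta, MulAut.conjNormal h a = a)
    (hy : K.y h = SettingModel.iotaZ (Multiplicative.ofAdd 1))
    (g : ↥(D.GtpY.map D.toTheta) → D.DeltaTheta)
    (hg : g ∈ contCocycles (MonoidHom.id D.GtpTheta) D.DeltaTheta (D.GtpY.map D.toTheta))
    (hgx : g ⟨h, hh⟩ = 1) (z : D.H1Theta (D.GtpY.map D.toTheta)) :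
    z ^ n ≠ K.logU * ContH1.mk g hg := by
  obtain ⟨f, hf, rfl⟩ := ContH1.exists_mk_eq z
  intro heq
  rw [ContH1.mk_pow, YCoordKit.logU, ContH1.mk_mul_mk] at heq
  have key := ContH1.apply_eq_of_mk_eq_mk_conj heq ⟨h, hh⟩ hcent
  erw [Pi.pow_apply, Pi.mul_apply, hgx, mul_one, logUFun_apply] at key
  obtain ⟨s, hs⟩ := hbij.2 (f ⟨h, hh⟩)
  have key' : K.iota (s ^ n) = K.iota (SettingModel.iotaZ (Multiplicative.ofAdd 1)) := by
    rw [map_pow, hs, ← hy]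
    exact key
  exact SettingModel.pow_ne_iotaZ_one hn s (hbij.1 key')

/-- **`K.logU` is not an `n`-th power over `Y` (`n ≥ 2`)** under the same hypotheses.
[cite: MochizukiEtTh2009, Prop 1.5 p.23] -/
theorem logU_not_pow_of_y_eq (hbij : Function.Bijective K.iota) {n : ℕ} (hn : 2 ≤ n)
    {h : D.GtpTheta} (hh : h ∈ D.GtpY.map D.toTheta) (hcent : ∀ a : D.DeltaTheta, MulAut.conjNormal h a = a)
    (hy : K.y h = SettingModel.iotaZ (Multiplicative.ofAdd 1)) (z : D.H1Theta (D.GtpY.map D.toTheta)) :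
    z ^ n ≠ K.logU := by
  intro heq
  refine K.logU_mul_mk_not_pow_of_y_eq hbij hn hh hcent hy 1 (one_mem _) rfl z ?_
  rw [ContH1.mk_one, mul_one]
  exact heq

/-- **`K.logU · κ(u)` is not an `n`-th power over `Y` (`n ≥ 2`) for any constant `u`**, for the Kummer data of a core `C`
with `aug^Θ(h) = 1` (Kummer cocycles of constants vanish at `h`) — `log(U)` is PRIMITIVE modulo `F²`.
[cite: MochizukiEtTh2009, Prop 1.5 p.23] -/
theorem logU_mul_kumY_not_pow_of_y_eq (C : D.KummerCore) (hbij : Function.Bijective K.iota) {n : ℕ} (hn : 2 ≤ n)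
    {h : D.GtpTheta} (hh : h ∈ D.GtpY.map D.toTheta) (haug : C.augTheta h = 1)
    (hcent : ∀ a : D.DeltaTheta, MulAut.conjNormal h a = a)
    (hy : K.y h = SettingModel.iotaZ (Multiplicative.ofAdd 1)) (u : ↥C.invY)
    (z : D.H1Theta (D.GtpY.map D.toTheta)) :
    z ^ n ≠ K.logU * C.toKummerData.kumY u := by
  obtain ⟨g, hg, hgeq⟩ := ContH1.exists_mk_eq (C.toKummerData.kumY u)
  rw [← hgeq]
  refine K.logU_mul_mk_not_pow_of_y_eq hbij hn hh hcent hy g hg ?_ z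
  exact C.kummerContMap_apply_eq_one _ u hgeq.symm ⟨h, hh⟩ haug hcent

/-- **`K.logUdd` does not descend to `Y`** when, in addition, restriction `H¹((Π^tp_Y)^Θ, Δ_Θ) → H¹((Π^tp_Ÿ)^Θ, Δ_Θ)` is
injective: a descent `w` would satisfy `(w²)|_Ÿ = log(U)|_Ÿ` (`K.res_logU`), hence `w² = log(U)`, contradicting the
case `n = 2`. [cite: MochizukiEtTh2009, Rmk 1.3.1 p.21] -/
theorem logUdd_not_mem_range_res_of_y_eq (hbij : Function.Bijective K.iota)
    {h : D.GtpTheta} (hh : h ∈ D.GtpY.map D.toTheta) (hcent : ∀ a : D.DeltaTheta, MulAut.conjNormal h a = a)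
    (hy : K.y h = SettingModel.iotaZ (Multiplicative.ofAdd 1))
    (hres : Function.Injective (ContH1.res (MonoidHom.id D.GtpTheta) D.DeltaTheta D.GtpYddTheta_le)) :
    K.logUdd ∉ Set.range (ContH1.res (MonoidHom.id D.GtpTheta) D.DeltaTheta D.GtpYddTheta_le) := by
  rintro ⟨w, hw⟩
  refine K.logU_not_pow_of_y_eq hbij le_rfl hh hcent hy w (hres ?_)
  rw [map_pow, hw, K.res_logU]

end YCoordKit

end ThetaSetting

/-! ## §2. The stage-2 (Tate-sheared) model `modelχq` -/

namespace SettingModel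

open Literature.AnabelianGeometry.SemiGraphs ThetaSetting

variable (p : ℕ) [Fact p.Prime] (i j : ℤ) (hj : Even j)

/-- The geometric test element `b ∈ Π^tp_Y` of the stage-2 model, in `(Π^tp_Y)^Θ`. [cite: MochizukiEtTh2009, §1 p.13] -/
theorem toTheta_inl_b_mem_gtpY_map_modelχq :
    CurveTheta.toTheta (curveχq p i j) (SemidirectProduct.inl (bPowGfp (iotaZ (Multiplicative.ofAdd 1)))) ∈
      (ThetaSetting.modelχq p i j hj).GtpY.map (ThetaSetting.modelχq p i j hj).toTheta := by
  refine ⟨_, ?_, rfl⟩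
  show (tateTwistData₀ p i j).toZ _ = 1
  rw [GfpTwistData₀.toZ_apply, SemidirectProduct.left_inl, gfpSnd_bPowGfp]

/-- It centralises `Δ_Θ(modelχq)`. [cite: MochizukiEtTh2009, §1 p.12] -/
theorem conjNormal_toTheta_inl_b_modelχq (a : (ThetaSetting.modelχq p i j hj).DeltaTheta) :
    MulAut.conjNormal (CurveTheta.toTheta (curveχq p i j)
      (SemidirectProduct.inl (bPowGfp (iotaZ (Multiplicative.ofAdd 1))))) a = a :=
  conjNormal_toThetaq_eq_self p i j hj (SemidirectProduct.right_inl _) a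

/-- `ŷ(b) = ι(1)` for the stage-2 kit. [cite: MochizukiEtTh2009, Prop 1.5 p.23] -/
theorem yCoordKitχq_y_inl_b :
    (yCoordKitχq p i j hj).y (CurveTheta.toTheta (curveχq p i j)
      (SemidirectProduct.inl (bPowGfp (iotaZ (Multiplicative.ofAdd 1))))) = iotaZ (Multiplicative.ofAdd 1) := by
  show yThetaχq p i j (CurveTheta.toTheta (curveχq p i j) _) = _
  rw [yThetaχq_toTheta, yCoordχq_inl_bPowGfp]

/-- The stage-2 kit's `ι` is bijective (`Δ_Θ(modelχq) ≅ Ẑ`; the kit's `ι` is `deltaThetaCoordχq` by definition).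
[cite: MochizukiEtTh2009, §1 p.12] -/
theorem yCoordKitχq_iota_bijective : Function.Bijective (yCoordKitχq p i j hj).iota :=
  bijective_deltaThetaCoordχq p i j

/-- `aug^Θ(b) = 1`: the geometric test element has trivial Galois part (definitional). [cite: MochizukiEtTh2009, §1 p.12] -/
theorem augTheta_kummerCoreχq_inl_b :
    (kummerCoreχq p i j hj).augTheta (CurveTheta.toTheta (curveχq p i j)
      (SemidirectProduct.inl (bPowGfp (iotaZ (Multiplicative.ofAdd 1))))) = 1 := rfl

/-- **Stage 2: `log(U)` is not an `n`-th power in `H¹((Π^tp_Y)^Θ, Δ_Θ)` (`n ≥ 2`) at `modelχq`.**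
[cite: MochizukiEtTh2009, Prop 1.5 p.23] -/
theorem logU_not_pow_modelχq {n : ℕ} (hn : 2 ≤ n)
    (z : (ThetaSetting.modelχq p i j hj).H1Theta
      ((ThetaSetting.modelχq p i j hj).GtpY.map (ThetaSetting.modelχq p i j hj).toTheta)) :
    z ^ n ≠ (kummerDataχq p i j hj).logU :=
  (yCoordKitχq p i j hj).logU_not_pow_of_y_eq (yCoordKitχq_iota_bijective p i j hj) hn
    (toTheta_inl_b_mem_gtpY_map_modelχq p i j hj) (conjNormal_toTheta_inl_b_modelχq p i j hj)
    (yCoordKitχq_y_inl_b p i j hj) z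

/-- **Stage 2: `log(U) · κ(u)` is not an `n`-th power over `Y` (`n ≥ 2`) for any constant `u`** — `log(U)` is PRIMITIVE
modulo `F² = κ(K^×)` at `modelχq` (the model content of «`F¹/F² = Ẑ · log(U)`» at stage 2; complements
abc-iut-w5-d181's `log(U) ∉ F²`, `log(U)^ℤ ∩ F² = 1` there). [cite: MochizukiEtTh2009, Prop 1.5 p.23] -/
theorem logU_mul_kumY_not_pow_modelχq {n : ℕ} (hn : 2 ≤ n) (u : ↥(kummerCoreχq p i j hj).invY)
    (z : (ThetaSetting.modelχq p i j hj).H1Theta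
      ((ThetaSetting.modelχq p i j hj).GtpY.map (ThetaSetting.modelχq p i j hj).toTheta)) :
    z ^ n ≠ (kummerDataχq p i j hj).logU * (kummerDataχq p i j hj).kumY u :=
  (yCoordKitχq p i j hj).logU_mul_kumY_not_pow_of_y_eq (kummerCoreχq p i j hj)
    (yCoordKitχq_iota_bijective p i j hj) hn (toTheta_inl_b_mem_gtpY_map_modelχq p i j hj)
    (augTheta_kummerCoreχq_inl_b p i j hj) (conjNormal_toTheta_inl_b_modelχq p i j hj)
    (yCoordKitχq_y_inl_b p i j hj) u z

/-- **Stage 2, Rmk. 1.3.1: `log(U)` has NO square root over `Y` at `modelχq`** — "`½ · log(U)`" does not exist in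
`H¹((Π^tp_Y)^Θ, Δ_Θ)`, although `log(U)|_Ÿ = log(Ü)²` (`YCoordKit.res_logU`). [cite: MochizukiEtTh2009, Rmk 1.3.1 p.21] -/
theorem logU_not_sq_modelχq
    (z : (ThetaSetting.modelχq p i j hj).H1Theta
      ((ThetaSetting.modelχq p i j hj).GtpY.map (ThetaSetting.modelχq p i j hj).toTheta)) :
    z ^ 2 ≠ (kummerDataχq p i j hj).logU :=
  logU_not_pow_modelχq p i j hj le_rfl z

/-- … nor has `log(U) · κ(u)` a square root, for any constant `u` (the «up to `O^×`-Kummer action» form).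
[cite: MochizukiEtTh2009, Rmk 1.3.1 p.21] -/
theorem logU_mul_kumY_not_sq_modelχq (u : ↥(kummerCoreχq p i j hj).invY)
    (z : (ThetaSetting.modelχq p i j hj).H1Theta
      ((ThetaSetting.modelχq p i j hj).GtpY.map (ThetaSetting.modelχq p i j hj).toTheta)) :
    z ^ 2 ≠ (kummerDataχq p i j hj).logU * (kummerDataχq p i j hj).kumY u :=
  logU_mul_kumY_not_pow_modelχq p i j hj le_rfl u z

/-- While over `Ÿ` the restricted class IS a square at stage 2 as well (`log(U)|_Ÿ = log(Ü)²`).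
[cite: MochizukiEtTh2009, Prop 1.5 p.23] -/
theorem res_logU_eq_logUdd_sq_modelχq :
    ContH1.res (MonoidHom.id (ThetaSetting.modelχq p i j hj).GtpTheta) (ThetaSetting.modelχq p i j hj).DeltaTheta
        (ThetaSetting.modelχq p i j hj).GtpYddTheta_le (kummerDataχq p i j hj).logU =
      (kummerDataχq p i j hj).logUdd ^ 2 :=
  (kummerDataχq p i j hj).res_logU

/-- **`Δ_Θ(modelχq)` has no non-trivial element fixed by `(Π^tp_Ÿ)^Θ`** (conjugation runs through `χ(G_K̈)`,
`deltaThetaCoordχq_chi`; `Ẑ(χ)` has no invariants under the open `G_K̈`, abc-iut-w5-d091's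
`eq_one_of_forall_chi_apply_eq_of_isOpen`). [cite: MochizukiEtTh2009, §1 p.12] -/
theorem deltaTheta_eq_one_of_forall_gtpYdd_conj_eq_modelχq (a : (ThetaSetting.modelχq p i j hj).DeltaTheta)
    (ha : ∀ n : (ThetaSetting.modelχq p i j hj).GtpTheta,
      n ∈ (ThetaSetting.modelχq p i j hj).GtpYdd.map (ThetaSetting.modelχq p i j hj).toTheta →
        MulAut.conjNormal n a = a) :
    a = 1 := by
  obtain ⟨t, rfl⟩ := (bijective_deltaThetaCoordχq p i j).2 a
  haveI := (kummerCoreχq p i j hj).finiteDimensional_Kdd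
  have ht : t = 1 := by
    refine eq_one_of_forall_chi_apply_eq_of_isOpen p (ThetaSetting.modelχq p i j hj).Kdd.fixingSubgroup
      (IntermediateField.fixingSubgroup_isOpen _) fun σ hσ => ?_
    rw [← (kummerCoreχq p i j hj).map_augTheta_gtpYdd] at hσ
    obtain ⟨n, hn, rfl⟩ := hσ
    apply (bijective_deltaThetaCoordχq p i j).1
    rw [show (kummerCoreχq p i j hj).augTheta n = CurveTheta.augTheta (curveχq p i j) n from rfl,
      deltaThetaCoordχq_chi]
    exact ha n hn
  rw [ht]
  exact map_one (deltaThetaCoordχq p i j)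

/-- Hence **restriction `H¹((Π^tp_Y)^Θ, Δ_Θ) → H¹((Π^tp_Ÿ)^Θ, Δ_Θ)` is injective at `modelχq`**.
[cite: MochizukiEtTh2009, Prop 1.5 p.23] -/
theorem res_gtpYdd_injective_modelχq :
    Function.Injective (ContH1.res (MonoidHom.id (ThetaSetting.modelχq p i j hj).GtpTheta)
      (ThetaSetting.modelχq p i j hj).DeltaTheta (ThetaSetting.modelχq p i j hj).GtpYddTheta_le) := by
  haveI := (ThetaSetting.modelχq p i j hj).compat.GtpYddTheta_normal
  exact ContH1.res_injective_of_forall_fixed_eq_one' _ fun a ha =>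
    deltaTheta_eq_one_of_forall_gtpYdd_conj_eq_modelχq p i j hj a fun n hn => by
      simpa only [MonoidHom.id_apply] using ha n hn

/-- **Stage 2, Rmk. 1.3.1 descent form: `log(Ü)` is NOT the restriction of any class over `Y` at `modelχq`**
(«the divisor `D₁` on `Ÿ` does not descend to `Y`», Kummer-class form, at the Tate-sheared model).
[cite: MochizukiEtTh2009, Rmk 1.3.1 p.21] -/
theorem logUdd_not_mem_range_res_modelχq :
    (kummerDataχq p i j hj).logUdd ∉ Set.range (ContH1.res (MonoidHom.id (ThetaSetting.modelχq p i j hj).GtpTheta)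
      (ThetaSetting.modelχq p i j hj).DeltaTheta (ThetaSetting.modelχq p i j hj).GtpYddTheta_le) :=
  (yCoordKitχq p i j hj).logUdd_not_mem_range_res_of_y_eq (yCoordKitχq_iota_bijective p i j hj)
    (toTheta_inl_b_mem_gtpY_map_modelχq p i j hj) (conjNormal_toTheta_inl_b_modelχq p i j hj)
    (yCoordKitχq_y_inl_b p i j hj) (res_gtpYdd_injective_modelχq p i j hj)

include i j hj in
/-- CENSUS (stage 2): a theta setting at an [EtTh] origin with Kummer data whose `log(U)` is primitive modulo the Kummer
classes and has no square root over `Y`. [cite: MochizukiEtTh2009, Rmk 1.3.1 p.21] -/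
theorem exists_isEtThOrigin_kummerData_logU_primitive_stage2 {n : ℕ} (hn : 2 ≤ n) :
    ∃ D : ThetaSetting p, D.IsEtThOrigin ∧ ∃ E : D.KummerData,
      (∀ z : D.H1Theta (D.GtpY.map D.toTheta), z ^ n ≠ E.logU) ∧
        ∀ (u : E.KHat) (z : D.H1Theta (D.GtpY.map D.toTheta)), z ^ n ≠ E.logU * E.kumY u :=
  ⟨ThetaSetting.modelχq p i j hj, ThetaSetting.modelχq_isEtThOrigin p i j hj, kummerDataχq p i j hj,
    fun z => logU_not_pow_modelχq p i j hj hn z, fun u z => logU_mul_kumY_not_pow_modelχq p i j hj hn u z⟩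

end SettingModel

end Literature.AnabelianGeometry.EtaleTheta

end
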